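import Mathlib
import Summits.CriticalPhenomena.CardyFormulaZ2.Theses.CardyWhiteToColoured
import Literature.Probability.Percolation.SmoothedWhiteNoise
import Summits.CriticalPhenomena.CardyFormulaZ2.Theorems.CardyWhiteToColouredDriftBoundStubWhiteWindow
import Summits.CriticalPhenomena.CardyFormulaZ2.Theorems.CardyWhiteToColouredModelExists

/-!
# `DriftBound` from three windows — the composition of the strategist line `three_windows`

Route `CriticalPhenomena/CardyFormulaZ2/CardyWhiteToColoured`, crux `DriftBound`
(item `stmt-CriticalPhenomena-4596`), registered sub-goal `driftBound_of_threeWindows` of the line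
`Cruxes/DriftBound/Lines/three_windows.lean` (strategist unit `cstrat-stmt-CriticalPhenomena-4596-s1`).

**Theorem (sorry-free).** `LatticeWindow → UniformDiscretisation → ContinuumScalingLimit → DriftBound`,
where (all objects from `Literature.Probability.Percolation.SmoothedWhiteNoise`, `rfl`-bridged to the
route's inline terms):

* `LatticeWindow` (C1): for `δ < δ₀` and `δ/(1+|log δ|) ≤ s₁ ≤ s₂`, `s₂ ^ 8 ≤ δ`:
  `|P^latt_{s₂,δ}(R) − P^latt_{s₁,δ}(R)| < ε` (lattice only);
* `UniformDiscretisation` (C2): `|P^latt_{s,δ}(R) − P^cont_s(R)| < ε` uniformly in `δ ≤ s ^ 8`, `s ≤ ℓ₀`;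
* `ContinuumScalingLimit` (C3): `P^cont_ℓ(R)` converges as `ℓ → 0⁺` (continuum only).

Proof: the white noise `μ` and bump family `k` come from the landed `ModelExists`
(`Theorems.cardyWhiteToColoured_modelExists_proof`); with the landed white window
`Cruxes.DriftBound.Birth.stub_whiteWindow` (B1: `P_δ ≈ P^latt_{s⋆,δ}`, `s⋆ = δ/(1+|log δ|)`) chain
`P_δ ≈ P^latt_{s⋆,δ} ≈ P^latt_{t,δ} ≈ P^cont_t ≈ Ψ ≈ P^cont_ℓ ≈ P^latt_{ℓ,δ}` with `t = δ^{1/8}`, six pieces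
of `ε/6`; `ℓ₀ := min ℓ₁ ℓ₂`, `δ₀ := min (min (min δ₁ δ₂) (min δ₃ 1)) (ℓ ^ 8)`.
It is the glue of the (proposed) route-level split of `DriftBound` into these three children.
-/

namespace Summit.CriticalPhenomena.CardyFormulaZ2.Cruxes.DriftBound.ThreeWindows

open Set Filter Topology MeasureTheory
open Literature.Probability.LatticeModels Literature.Probability.Percolation
open Literature.Probability.RandomPlanarGeometry

/-! ## Elementary scale bookkeeping -/

/-- The mesoscopic scale `t = δ^{1/8}`: positive, `t ^ 8 = δ`, and `δ ≤ t ≤ 1` when `δ ≤ 1`. -/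
theorem tw_mesoScale_spec {δ : ℝ} (hδ : 0 < δ) (hδ1 : δ ≤ 1) :
    0 < δ ^ ((1 : ℝ) / 8) ∧ (δ ^ ((1 : ℝ) / 8)) ^ 8 = δ ∧ δ ≤ δ ^ ((1 : ℝ) / 8) ∧ δ ^ ((1 : ℝ) / 8) ≤ 1 := by
  have ht0 : 0 < δ ^ ((1 : ℝ) / 8) := Real.rpow_pos_of_pos hδ _
  have ht8 : (δ ^ ((1 : ℝ) / 8)) ^ 8 = δ := by
    rw [← Real.rpow_natCast, ← Real.rpow_mul hδ.le]
    norm_num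
  have ht1 : δ ^ ((1 : ℝ) / 8) ≤ 1 := Real.rpow_le_one hδ.le hδ1 (by norm_num)
  refine ⟨ht0, ht8, ?_, ht1⟩
  -- `δ = t ^ 8 ≤ t` because `0 ≤ t ≤ 1`
  calc δ = (δ ^ ((1 : ℝ) / 8)) ^ 8 := ht8.symm
    _ ≤ (δ ^ ((1 : ℝ) / 8)) ^ 1 := pow_le_pow_of_le_one ht0.le ht1 (by norm_num)
    _ = δ ^ ((1 : ℝ) / 8) := pow_one _

/-- From a right-limit at `0` to an `ε`-window: if `P ℓ → Ψ` as `ℓ → 0⁺` then for every `ε > 0`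
there is `ℓ₁ > 0` with `|P ℓ − Ψ| < ε` for all `0 < ℓ < ℓ₁`. -/
theorem tw_window_of_tendsto {P : ℝ → ℝ} {Ψ : ℝ}
    (h : Filter.Tendsto P (nhdsWithin 0 (Set.Ioi 0)) (nhds Ψ)) {ε : ℝ} (hε : 0 < ε) :
    ∃ ℓ₁ : ℝ, 0 < ℓ₁ ∧ ∀ ℓ : ℝ, 0 < ℓ → ℓ < ℓ₁ → |P ℓ - Ψ| < ε := by
  have hev : ∀ᶠ ℓ in nhdsWithin 0 (Set.Ioi 0), dist (P ℓ) Ψ < ε := Metric.tendsto_nhds.1 h ε hε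
  obtain ⟨u, hu, hsub⟩ := mem_nhdsGT_iff_exists_Ioo_subset.1 hev
  refine ⟨u, hu, fun ℓ hℓ hℓu => ?_⟩
  have := hsub ⟨hℓ, hℓu⟩
  simpa [Real.dist_eq] using this

/-! ## The composition: the three windows give the crux -/

/-- **`DriftBound` from the three windows** (sorry-free; uses the LANDED white window
`Birth.stub_whiteWindow` and the LANDED `ModelExists`).  For `ε > 0`: `Ψ, ℓ₁` from C3 (twice, at
`t` and at `ℓ`), `ℓ₂, δ₂` from C2, `δ₁` from C1, `δ₃` from B1; `ℓ₀ := min ℓ₁ ℓ₂`; given `ℓ < ℓ₀`,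
`δ₀ := min (min (min δ₁ δ₂) (min δ₃ 1)) (ℓ ^ 8)`; for `δ < δ₀` put `s⋆ = δ/(1+|log δ|)`,
`t = δ^{1/8}` (`s⋆ ≤ δ ≤ t ≤ ℓ`), and chain the six `ε/6`-estimates. -/
theorem driftBound_of_threeWindows :
    (∀ R : Literature.Probability.RandomPlanarGeometry.ConformalRectangle, ∀ ε : ℝ, 0 < ε → ∃ δ₀ : ℝ, 0 < δ₀ ∧ ∀ δ : ℝ, 0 < δ → δ < δ₀ → ∀ s₁ s₂ : ℝ, δ / (1 + |Real.log δ|) ≤ s₁ → s₁ ≤ s₂ → s₂ ^ 8 ≤ δ → |Literature.Probability.Percolation.smoothedCrossingProb s₂ δ R.carrier (R.arc 0) (R.arc 2) - Literature.Probability.Percolation.smoothedCrossingProb s₁ δ R.carrier (R.arc 0) (R.arc 2)| < ε) → (∀ μ : MeasureTheory.Measure (Literature.MathematicalPhysics.QuantumLattice.FieldConfig ℂ), Literature.Probability.Percolation.IsWhiteNoise μ → ∀ k : ℝ → ℂ → SchwartzMap ℂ ℝ, Literature.Probability.Percolation.IsGaussianBumpFamily k → ∀ R : Literature.Probability.RandomPlanarGeometry.ConformalRectangle,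 ∀ ε : ℝ, 0 < ε → ∃ ℓ₀ : ℝ, 0 < ℓ₀ ∧ ∃ δ₀ : ℝ, 0 < δ₀ ∧ ∀ δ : ℝ, 0 < δ → δ < δ₀ → ∀ s : ℝ, 0 < s → δ ≤ s ^ 8 → s ≤ ℓ₀ → |Literature.Probability.Percolation.smoothedCrossingProb s δ R.carrier (R.arc 0) (R.arc 2) - Literature.Probability.Percolation.continuumCrossingProb μ k s R| < ε) → (∀ μ : MeasureTheory.Measure (Literature.MathematicalPhysics.QuantumLattice.FieldConfig ℂ), Literature.Probability.Percolation.IsWhiteNoise μ → ∀ k : ℝ → ℂ → SchwartzMap ℂ ℝ, Literature.Probability.Percolation.IsGaussianBumpFamily k → ∀ R : Literature.Probability.RandomPlanarGeometry.ConformalRectangle, ∃ Ψ : ℝ, Filter.Tendsto (fun ℓ : ℝ => Literature.Probability.Percolation.continuumCrossingProb μ k ℓ R) (nhdsWithin 0 (Set.Ioi 0)) (nhds Ψ)) → Summit.CriticalPhenomena.CardyFormulaZ2.Theses.CardyWhiteToColoured.DriftBound := by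
  intro hC1 hC2 hC3
  -- the model: a white noise `μ` and a Gaussian bump family `k` (landed `ModelExists`)
  obtain ⟨⟨μ, hμG, hμgen⟩, k, hk⟩ :=
    Summit.CriticalPhenomena.CardyFormulaZ2.Theorems.cardyWhiteToColoured_modelExists_proof
  have hμ : Literature.Probability.Percolation.IsWhiteNoise μ := ⟨hμG, hμgen⟩
  have hk' : Literature.Probability.Percolation.IsGaussianBumpFamily k := hk
  intro R ε hε
  have hε6 : (0 : ℝ) < ε / 6 := by positivity
  -- C3: the continuum limit `Ψ` and its window `ℓ₁`
  obtain ⟨Ψ, hΨ⟩ := hC3 μ hμ k hk' R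
  obtain ⟨ℓ₁, hℓ₁, H3⟩ := tw_window_of_tendsto hΨ hε6
  -- C2, C1, B1
  obtain ⟨ℓ₂, hℓ₂, δ₂, hδ₂, H2⟩ := hC2 μ hμ k hk' R (ε / 6) hε6
  obtain ⟨δ₁, hδ₁, H1⟩ := hC1 R (ε / 6) hε6
  obtain ⟨δ₃, hδ₃, HB⟩ :=
    Summit.CriticalPhenomena.CardyFormulaZ2.Cruxes.DriftBound.Birth.stub_whiteWindow R (ε / 6) hε6
  refine ⟨min ℓ₁ ℓ₂, lt_min hℓ₁ hℓ₂, fun ℓ hℓ hℓlt => ?_⟩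
  have hℓ1 : ℓ < ℓ₁ := lt_of_lt_of_le hℓlt (min_le_left _ _)
  have hℓ2 : ℓ < ℓ₂ := lt_of_lt_of_le hℓlt (min_le_right _ _)
  refine ⟨min (min (min δ₁ δ₂) (min δ₃ 1)) (ℓ ^ 8),
    lt_min (lt_min (lt_min hδ₁ hδ₂) (lt_min hδ₃ one_pos)) (pow_pos hℓ 8), fun δ hδ hδlt => ?_⟩
  have hδ₁' : δ < δ₁ :=
    lt_of_lt_of_le hδlt ((min_le_left _ _).trans ((min_le_left _ _).trans (min_le_left _ _)))
  have hδ₂' : δ < δ₂ :=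
    lt_of_lt_of_le hδlt ((min_le_left _ _).trans ((min_le_left _ _).trans (min_le_right _ _)))
  have hδ₃' : δ < δ₃ :=
    lt_of_lt_of_le hδlt ((min_le_left _ _).trans ((min_le_right _ _).trans (min_le_left _ _)))
  have hδone : δ ≤ 1 :=
    (lt_of_lt_of_le hδlt ((min_le_left _ _).trans ((min_le_right _ _).trans (min_le_right _ _)))).le
  have hδℓ8 : δ ≤ ℓ ^ 8 := (lt_of_lt_of_le hδlt (min_le_right _ _)).le
  -- the scales `s⋆ ≤ δ ≤ t ≤ ℓ`
  have h1log : (1 : ℝ) ≤ 1 + |Real.log δ| := le_add_of_nonneg_right (abs_nonneg _)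
  have hspos : 0 < δ / (1 + |Real.log δ|) := div_pos hδ (one_pos.trans_le h1log)
  have hsle : δ / (1 + |Real.log δ|) ≤ δ := div_le_self hδ.le h1log
  set s := δ / (1 + |Real.log δ|) with hs
  obtain ⟨ht0, ht8, hδt, ht1⟩ := tw_mesoScale_spec hδ hδone
  set t := δ ^ ((1 : ℝ) / 8) with ht
  have hst : s ≤ t := hsle.trans hδt
  have htℓ : t ≤ ℓ := by
    have : t ^ 8 ≤ ℓ ^ 8 := by rw [ht8]; exact hδℓ8
    exact le_of_pow_le_pow_left₀ (by norm_num) hℓ.le this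
  -- the six pieces
  have p1 : |smoothedCrossingProb s δ R.carrier (R.arc 0) (R.arc 2) - bondDomainCrossingProb R δ| < ε / 6 :=
    HB δ hδ hδ₃' s hspos le_rfl
  have p2 : |smoothedCrossingProb t δ R.carrier (R.arc 0) (R.arc 2)
      - smoothedCrossingProb s δ R.carrier (R.arc 0) (R.arc 2)| < ε / 6 :=
    H1 δ hδ hδ₁' s t le_rfl hst ht8.le
  have p3 : |smoothedCrossingProb t δ R.carrier (R.arc 0) (R.arc 2) - continuumCrossingProb μ k t R| < ε / 6 :=
    H2 δ hδ hδ₂' t ht0 ht8.ge (htℓ.trans hℓ2.le)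
  have p4 : |continuumCrossingProb μ k t R - Ψ| < ε / 6 := H3 t ht0 (htℓ.trans_lt hℓ1)
  have p5 : |continuumCrossingProb μ k ℓ R - Ψ| < ε / 6 := H3 ℓ hℓ hℓ1
  have p6 : |smoothedCrossingProb ℓ δ R.carrier (R.arc 0) (R.arc 2) - continuumCrossingProb μ k ℓ R| < ε / 6 :=
    H2 δ hδ hδ₂' ℓ hℓ hδℓ8 hℓ2.le
  have h : |bondDomainCrossingProb R δ - smoothedCrossingProb ℓ δ R.carrier (R.arc 0) (R.arc 2)| < ε := by
    have q1 := abs_sub_lt_iff.1 p1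
    have q2 := abs_sub_lt_iff.1 p2
    have q3 := abs_sub_lt_iff.1 p3
    have q4 := abs_sub_lt_iff.1 p4
    have q5 := abs_sub_lt_iff.1 p5
    have q6 := abs_sub_lt_iff.1 p6
    rw [abs_sub_lt_iff]
    constructor <;> linarith
  rw [smoothedCrossingProb_conformalRectangle_eq] at h
  exact h

end Summit.CriticalPhenomena.CardyFormulaZ2.Cruxes.DriftBound.ThreeWindows
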